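import Summits.HubbardSuperconductivity.HubbardSuperconductivity.Theses.KacWindowPenalty
import Summits.HubbardSuperconductivity.HubbardSuperconductivity.Theorems.BalabanIRBirEveryGroundStateSchur
import Summits.HubbardSuperconductivity.HubbardSuperconductivity.Theorems.TwTipContinuation.Negative.TipNormalForm
import Literature.MathematicalPhysics.QuantumLattice.PairFieldMomentum

/-!
# Route `KacWindowPenalty` — glue layer: `TargetOfCruxes` (stmt-HubbardSuperconductivity-14282),
`TargetImpliesSummit` (stmt-1091) and `Assembly` (stmt-1092)

The provable-now glue of route `KacWindowPenalty` (card `kac-window-penalty-sandwich`), in one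
module (the route's `Sandwich`, stmt-1090, is `Theorems/KacWindowPenaltySandwich.lean`):

* `kacWindowPenalty_targetOfCruxes_proof : TargetOfCruxes` — `WindowGap → WindowInfraredBound →
  Target`, pure logic (`σ := C ε`, threshold `max L₀ L₁`; the body of the route's certified deciding
  theorem minus its first line).
* `kacWindowPenalty_targetImpliesSummit_proof : TargetImpliesSummit` — `Target →
  HubbardSuperconductivity`. The target delivers `U > 0`, `δ ∈ (0, 1/2)`, `ε, λ, a > 0`, `σ ≥ 0`,
  `L₀` such that at every even side `L ≥ L₀` (gap) `λ(σ + a)L² ≤ minEnergyOn (H_L + λW) K_L −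
  minEnergyOn H_L K_L` and (tail) `T_ε(ψ) ≤ σL²` for every normalised sector ground state `ψ` of
  `H_L = hubbardTorus 2 L 1 U` (`K_L = szSector N_L 0`, `W = L⁻² Σ_{|q_m| ≤ ε} Δ_d(m)ᴴ Δ_d(m)` the
  Kac-window pair penalty, `T_ε(ψ) = L⁻² Σ_{m ≠ 0, |q_m| ≤ ε} ‖Δ_d(m)ψ‖²` the window tail,
  `Δ_d(m) = pairFieldAt dWaveFormFactor L m` — the route's `let D` is verbatim the body of
  `pairFieldAt`, `Literature/…/PairFieldMomentum.lean`). Steps: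
  `re_dotProduct_kacWindow_mulVec` (`Re ⟨ψ, W ψ⟩ = Σ_{|q_m| ≤ ε} ‖Δ_d(m) ψ‖² / L²`),
  `sum_ite_eq_add_sum_ite_ne_and` (split of a windowed sum at `m = 0`),
  `kacWindowPenalty_everyGS_floor` (sandwich `chord_div_le_re_expect_of_eigen` + (gap) ⇒
  `(σ + a)L² ≤ Re ⟨ψ, W ψ⟩ = ‖Δ_d(0)ψ‖²/L² + T_ε(ψ)`; with (tail) and `Δ_d(0) = pairField`
  (`pairFieldAt_zero`): `a L⁴ ≤ Re ⟨ψ, Δ_dᴴ Δ_d ψ⟩` for EVERY normalised sector ground state), and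
  the even-side `liminf` bookkeeping `summitMatrix_of_everyGSOrder`
  (`Theorems/TwTipContinuation/Negative/TipNormalForm.lean`).
* `kacWindowPenalty_assembly_proof : Assembly` — `WindowGap → WindowInfraredBound →
  HubbardSuperconductivity`, the composition of the two.

Sources: D. J. Scalapino, Phys. Rep. 250 (1995) 329, §2, (2.4); Wang et al., arXiv:2310.05844, §II
(certified observables from energy sandwiches). No new definitions.
-/

-- the mandated namespace `Summit.<Summit>.<Problem>.Theorems` repeats `HubbardSuperconductivity`
-- (single-problem summit, D-0017), which the `dupNamespace` linter flags on every declaration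
set_option linter.dupNamespace false

namespace Summit.HubbardSuperconductivity.HubbardSuperconductivity.Theorems

open Matrix Literature.MathematicalPhysics.QuantumLattice
open Summit.HubbardSuperconductivity.TwTipContinuation.Negative (summitMatrix_of_everyGSOrder)

/-! ### The glue `TargetOfCruxes` -/

/-- **Glue of route `KacWindowPenalty`** (stmt-HubbardSuperconductivity-14282):
`WindowGap → WindowInfraredBound → Target`, with `σ := C·ε` and threshold `max L₀ L₁` (see the
module docstring). Eight lines of logic, identical to the body of the route's deciding theorem.
[folklore] -/
theorem kacWindowPenalty_targetOfCruxes_proof :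
    Summit.HubbardSuperconductivity.HubbardSuperconductivity.Theses.KacWindowPenalty.TargetOfCruxes := by
  intro hGap hIR
  obtain ⟨U, hU, δ, hδ, hG⟩ := hGap
  obtain ⟨C, ε₀, hC, hε₀, L₁, hI⟩ := hIR U hU δ hδ
  obtain ⟨ε, hε, lam, a, hlam, ha, L₀, hG⟩ := hG C hC ε₀ hε₀
  refine ⟨U, hU, δ, hδ, ε, lam, C * ε, a, hε.1, hlam, mul_nonneg hC hε.1.le, ha, max L₀ L₁, ?_⟩
  intro L _ hL hEven
  exact ⟨hG L (le_of_max_le_left hL) hEven,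
    fun ψ hψ hGS => hI ε hε L (le_of_max_le_right hL) hEven ψ hψ hGS⟩

/-! ### `TargetImpliesSummit` -/

/-- **Expectation of the Kac-window pair penalty.** For the window operator
`W = Σ_m [ |q_m| ≤ ε ] L⁻² • Δ_d(m)ᴴ Δ_d(m)` and any Fock vector `ψ`,
`Re ⟨ψ, W ψ⟩ = Σ_m [ |q_m| ≤ ε ] ‖Δ_d(m) ψ‖² / L²` (linearity of `⟨ψ, · ψ⟩` in the operator and
`⟨ψ, Δᴴ Δ ψ⟩ = ⟨Δ ψ, Δ ψ⟩`, `star_mulVec_dotProduct_mulVec`). Scalapino, Phys. Rep. 250 (1995)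
329, §2. [folklore] -/
theorem re_dotProduct_kacWindow_mulVec (L : ℕ) [NeZero L] (ε : ℝ)
    (ψ : Fock (Orb (FermionTorus 2 L))) :
    (star ψ ⬝ᵥ (∑ m : Fin 2 → ZMod L,
        if (2 * Real.pi / (L : ℝ)) ^ 2 * (∑ i : Fin 2, (((m i).valMinAbs : ℤ) : ℝ) ^ 2) ≤ ε ^ 2 then
          ((L : ℂ) ^ 2)⁻¹ •
            (Matrix.conjTranspose (pairFieldAt dWaveFormFactor L m) * pairFieldAt dWaveFormFactor L m)
        else 0) *ᵥ ψ).re =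
      ∑ m : Fin 2 → ZMod L,
        if (2 * Real.pi / (L : ℝ)) ^ 2 * (∑ i : Fin 2, (((m i).valMinAbs : ℤ) : ℝ) ^ 2) ≤ ε ^ 2 then
          (star (Matrix.mulVec (pairFieldAt dWaveFormFactor L m) ψ) ⬝ᵥ
              Matrix.mulVec (pairFieldAt dWaveFormFactor L m) ψ).re / (L : ℝ) ^ 2
        else 0 := by
  have hc : ((((L : ℝ) ^ 2)⁻¹ : ℝ) : ℂ) = ((L : ℂ) ^ 2)⁻¹ := by
    rw [Complex.ofReal_inv, Complex.ofReal_pow, Complex.ofReal_natCast]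
  rw [sum_mulVec, dotProduct_sum, Complex.re_sum]
  refine Finset.sum_congr rfl fun m _ => ?_
  split_ifs with hm
  · rw [smul_mulVec, dotProduct_smul, smul_eq_mul, ← star_mulVec_dotProduct_mulVec, ← hc,
      Complex.re_ofReal_mul, div_eq_inv_mul]
  · rw [zero_mulVec, dotProduct_zero, Complex.zero_re]

/-- Splitting a windowed finite sum at one label `a` inside the window:
`Σ_m [w m] S m = S a + Σ_m [m ≠ a ∧ w m] S m`. [folklore] -/
theorem sum_ite_eq_add_sum_ite_ne_and {α : Type*} [Fintype α] [DecidableEq α] (w : α → Prop)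
    [DecidablePred w] (S : α → ℝ) (a : α) (ha : w a) :
    (∑ m, if w m then S m else 0) = S a + ∑ m, if m ≠ a ∧ w m then S m else 0 := by
  have hpt : ∀ m, (if w m then S m else 0) =
      (if m = a then S m else 0) + (if m ≠ a ∧ w m then S m else 0) := by
    intro m
    by_cases hm : m = a
    · subst hm
      rw [if_pos ha, if_pos rfl, if_neg (fun h => h.1 rfl), add_zero]
    · rw [if_neg hm, zero_add]
      by_cases hw : w m
      · rw [if_pos hw, if_pos ⟨hm, hw⟩]
      · rw [if_neg hw, if_neg (fun h => hw h.2)]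
  rw [Finset.sum_congr rfl fun m _ => hpt m, Finset.sum_add_distrib,
    Finset.sum_eq_single a (fun b _ hb => if_neg hb) (fun h => (h (Finset.mem_univ a)).elim),
    if_pos rfl]

/-- **Every ground state inherits the window floor** (route `KacWindowPenalty`, the sandwich +
subtraction step of `TargetImpliesSummit`, at one side `L`). Let `H = hubbardTorus 2 L 1 U`,
`K = szSector N 0`, `W = Σ_m [ |q_m| ≤ ε ] L⁻² • Δ_d(m)ᴴ Δ_d(m)` (`Δ_d(m) = pairFieldAt dWaveFormFactor L m`),
`λ > 0`. If (gap) `λ(σ + a)L² ≤ minEnergyOn (H + λW) K − minEnergyOn H K`, then every normalised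
sector ground state `ψ` of `H` whose window tail obeys `Σ_m [m ≠ 0 ∧ |q_m| ≤ ε] ‖Δ_d(m)ψ‖²/L² ≤ σL²`
has `a L⁴ ≤ Re ⟨ψ, Δ_dᴴ Δ_d ψ⟩`. Proof: the sandwich `minEnergyOn (H + λW) K − minEnergyOn H K ≤
λ Re ⟨ψ, W ψ⟩` (`chord_div_le_re_expect_of_eigen`) gives `(σ + a)L² ≤ Re ⟨ψ, W ψ⟩`; by
`re_dotProduct_kacWindow_mulVec` and the split at `m = 0` (which lies in the window,
`valMinAbs 0 = 0`) this is `‖Δ_d(0)ψ‖²/L² + tail`, and `Δ_d(0) = pairField` (`pairFieldAt_zero`).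
Scalapino, Phys. Rep. 250 (1995) 329, §2, (2.4); Wang et al., arXiv:2310.05844, §II. [folklore] -/
theorem kacWindowPenalty_everyGS_floor (L : ℕ) [NeZero L] (U : ℝ) (N : ℕ) {ε lam σ a : ℝ}
    (hlam : 0 < lam)
    (hgap : lam * (σ + a) * (L : ℝ) ^ 2 ≤
      (hubbardTorus 2 L 1 U + (lam : ℂ) • (∑ m : Fin 2 → ZMod L,
          if (2 * Real.pi / (L : ℝ)) ^ 2 * (∑ i : Fin 2, (((m i).valMinAbs : ℤ) : ℝ) ^ 2) ≤ ε ^ 2 then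
            ((L : ℂ) ^ 2)⁻¹ •
              (Matrix.conjTranspose (pairFieldAt dWaveFormFactor L m) *
                pairFieldAt dWaveFormFactor L m)
          else 0)).minEnergyOn (szSector N 0) -
        (hubbardTorus 2 L 1 U).minEnergyOn (szSector N 0))
    {ψ : Fock (Orb (FermionTorus 2 L))} (hψ1 : star ψ ⬝ᵥ ψ = 1)
    (hψ : IsGroundStateInSector (hubbardTorus 2 L 1 U) N 0 ψ)
    (htail : (∑ m : Fin 2 → ZMod L,
        if m ≠ 0 ∧
            (2 * Real.pi / (L : ℝ)) ^ 2 * (∑ i : Fin 2, (((m i).valMinAbs : ℤ) : ℝ) ^ 2) ≤ ε ^ 2 then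
          (star (Matrix.mulVec (pairFieldAt dWaveFormFactor L m) ψ) ⬝ᵥ
              Matrix.mulVec (pairFieldAt dWaveFormFactor L m) ψ).re / (L : ℝ) ^ 2
        else 0) ≤ σ * (L : ℝ) ^ 2) :
    a * (L : ℝ) ^ 4 ≤
      (expect ((pairField dWaveFormFactor L)ᴴ * pairField dWaveFormFactor L) ψ).re := by
  have hL : (0 : ℝ) < (L : ℝ) := Nat.cast_pos.2 (Nat.pos_of_ne_zero (NeZero.ne L))
  have hL2 : (0 : ℝ) < (L : ℝ) ^ 2 := by positivity
  -- the sandwich: gap ≤ λ · Re ⟨ψ, W ψ⟩, with Re ⟨ψ, W ψ⟩ expanded over the window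
  have hs := le_trans hgap
    ((div_le_iff₀ hlam).1 (chord_div_le_re_expect_of_eigen _ _ _ hlam hψ.1 hψ1 hψ.2.2))
  rw [re_dotProduct_kacWindow_mulVec] at hs
  -- the zero label lies in the window
  have hw0 : (2 * Real.pi / (L : ℝ)) ^ 2 *
      (∑ i : Fin 2, ((((0 : Fin 2 → ZMod L) i).valMinAbs : ℤ) : ℝ) ^ 2) ≤ ε ^ 2 := by
    have h0 : ∀ i : Fin 2, ((((0 : Fin 2 → ZMod L) i).valMinAbs : ℤ) : ℝ) ^ 2 = 0 := fun i => by
      rw [Pi.zero_apply, ZMod.valMinAbs_zero, Int.cast_zero, sq, mul_zero]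
    rw [Finset.sum_congr rfl fun i _ => h0 i, Finset.sum_const_zero, mul_zero]
    positivity
  -- split the window sum at `m = 0`
  rw [sum_ite_eq_add_sum_ite_ne_and _ _ (0 : Fin 2 → ZMod L) hw0, pairFieldAt_zero] at hs
  -- `‖Δ_d ψ‖² = Re ⟨ψ, Δ_dᴴ Δ_d ψ⟩`
  rw [star_mulVec_dotProduct_mulVec] at hs
  change lam * (σ + a) * (L : ℝ) ^ 2 ≤
    ((expect ((pairField dWaveFormFactor L)ᴴ * pairField dWaveFormFactor L) ψ).re / (L : ℝ) ^ 2 +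
      ∑ m : Fin 2 → ZMod L,
        if m ≠ 0 ∧
            (2 * Real.pi / (L : ℝ)) ^ 2 * (∑ i : Fin 2, (((m i).valMinAbs : ℤ) : ℝ) ^ 2) ≤ ε ^ 2 then
          (star (Matrix.mulVec (pairFieldAt dWaveFormFactor L m) ψ) ⬝ᵥ
              Matrix.mulVec (pairFieldAt dWaveFormFactor L m) ψ).re / (L : ℝ) ^ 2
        else 0) * lam at hs
  -- arithmetic: λ(σ + a)L² ≤ (X/L² + tail)·λ, tail ≤ σL² ⟹ aL⁴ ≤ X
  set X := (expect ((pairField dWaveFormFactor L)ᴴ * pairField dWaveFormFactor L) ψ).re with hX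
  have h1 : (σ + a) * (L : ℝ) ^ 2 ≤ X / (L : ℝ) ^ 2 + σ * (L : ℝ) ^ 2 := by
    refine le_of_mul_le_mul_left ?_ hlam
    nlinarith [hs, htail]
  have h2 : a * (L : ℝ) ^ 2 ≤ X / (L : ℝ) ^ 2 := by linarith
  rw [le_div_iff₀ hL2] at h2
  calc a * (L : ℝ) ^ 4 = a * (L : ℝ) ^ 2 * (L : ℝ) ^ 2 := by ring
    _ ≤ X := h2

/-- **`TargetImpliesSummit` of route `KacWindowPenalty`** (stmt-HubbardSuperconductivity-1091):
the route target `X` (Kac-window gap + window tail bound at some `(U, δ)`, all large even `L`)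
implies the summit statement `HubbardSuperconductivity` with the SAME `(U, δ)`: by
`kacWindowPenalty_everyGS_floor` every normalised `(N_L, S^z = 0)`-sector ground state of the pure
model at every even `L ≥ L₀` has `a L⁴ ≤ Re ⟨ψ, Δ_dᴴ Δ_d ψ⟩`, and the even-side `liminf`
bookkeeping `summitMatrix_of_everyGSOrder` (sum of the pulled-back pair correlations over the
half-open box `=` `Re ⟨ψ, Δ_dᴴ Δ_d ψ⟩`, `card = (2k)²`, a-priori boundedness keeping Mathlib's real
`liminf` honest) gives the summit's matrix. Scalapino, Phys. Rep. 250 (1995) 329, §2, (2.4).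
[folklore] -/
theorem kacWindowPenalty_targetImpliesSummit_proof :
    Summit.HubbardSuperconductivity.HubbardSuperconductivity.Theses.KacWindowPenalty.TargetImpliesSummit := by
  unfold Summit.HubbardSuperconductivity.HubbardSuperconductivity.Theses.KacWindowPenalty.TargetImpliesSummit
    Summit.HubbardSuperconductivity.HubbardSuperconductivity.Theses.KacWindowPenalty.Target
    _root_.HubbardSuperconductivity Literature.Hubbard.DWaveSuperconductivityHubbard
  rintro ⟨U, hU, δ, hδ, ε, lam, σ, a, _hε, hlam, _hσ, ha, L₀, hT⟩
  refine ⟨U, hU, δ, hδ, summitMatrix_of_everyGSOrder ⟨a, ha, L₀, ?_⟩⟩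
  intro L inst hL₀ hE ψ hψ1 hψ
  obtain ⟨hgap, htail⟩ := hT L hL₀ hE
  exact kacWindowPenalty_everyGS_floor L U _ hlam hgap hψ1 hψ (htail ψ hψ1 hψ)

/-! ### The assembly -/

/-- **Assembly of route `KacWindowPenalty`** (stmt-HubbardSuperconductivity-1092):
`WindowGap → WindowInfraredBound → HubbardSuperconductivity`, as
`TargetImpliesSummit ∘ TargetOfCruxes`. Scalapino, Phys. Rep. 250 (1995) 329, §2. [folklore] -/
theorem kacWindowPenalty_assembly_proof :
    Summit.HubbardSuperconductivity.HubbardSuperconductivity.Theses.KacWindowPenalty.Assembly :=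
  fun hGap hIR =>
    kacWindowPenalty_targetImpliesSummit_proof (kacWindowPenalty_targetOfCruxes_proof hGap hIR)

end Summit.HubbardSuperconductivity.HubbardSuperconductivity.Theorems
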